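import Literature.NumberTheory.EllipticCurves.CofreeInvolutionRegular
import HarnessLib

/-!
# Frobenius rigidity on the cofree module `A = F²/𝒪²` of a framed rank-2 representation in residue characteristic `2`:
# the fixed points of a `2`-power iterate `g^{2^R}` twisted by a scalar `u ≡ 1` on `A[ϖ^∞]` are `0` (ODD trace) or everything (EVEN trace)

Topic `NumberTheory/EllipticCurves`, namespace `Literature.NumberTheory.EllipticCurves.GreenbergSelmer` (`Cofree ρ F`, `cofreeMk`, `lattice`,
`fracRepresentation`, `smul_cofreeMk` of `GreenbergSelmerNewform.lean`; `fracRepresentation_apply_two` of `CofreeInvolutionRegular.lean`).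
THEOREMS ONLY (no definition, no named fact, no instance, no notation, no `sorry`). Pure module algebra: `G` is any group, `ρ : G → GL₂(𝒪)`
framed, `(ϖ) ⊆ 𝒪` a maximal ideal containing `2`, `𝒪 → F` injective into a field with `ϖ ≠ 0`, `g : G` with `det ρ(g) ≡ 1 (mod ϖ)`, `u ∈ 𝒪`
with `u ≡ 1 (mod ϖ)` (in the application: `g` a Frobenius at a good place `v ∤ 2` of a weight-2 newform representation, `det ρ(g) = ℓ` odd,
`u = q_v^{2^R}` odd).

* §1 (`2 × 2` matrices over a commutative ring, after card `Ideas/stub-cmlambdalower-k1-g11.md` §A): `tr (N²) = (tr N)² − 2 det N`,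
  Cayley–Hamilton `N² = tr N • N − det N • 1`, in characteristic `2` `tr (M^{2^r}) = (tr M)^{2^r}` (private plumbing), and ODD-TRACE RIGIDITY:
  `det M = 1`, `tr M` a unit ⟹ no `M^{2^r}` has a non-zero fixed vector (`eq_zero_of_pow_two_pow_mulVec_eq_self`).
* §2 (squaring towers, `2 = ϖ c`): `(1 + ϖ • z)^{2^R} = 1 + ϖ^{R+1} • w` in any `𝒪`-algebra (`exists_one_add_smul_pow_two_pow_eq`).
* §3 (the cofree module): a `ϖ`-torsion class `a ∈ A[ϖ]` with `h • a = u • a` is `0` as soon as `ρ̄(h) − ū` has no kernel on `(𝒪/ϖ)²`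
  (`Cofree.eq_zero_of_smul_eq_smul_of_torsion_one`), and then so is every `ϖ^m`-torsion such class (`…_of_torsion`, induction on `m`).
* §4 **ODD trace** (`tr ρ(g) ∉ (ϖ)`): `g^{2^R} • a = u • a`, `ϖ^m • a = 0` ⟹ `a = 0` (`Cofree.eq_zero_of_pow_two_pow_smul_eq_smul`), and the
  `ℕ`-scalar form `g^{2^R} • a = q^{2^R} • a ⟹ a = 0` for `q` odd (`…_eq_nsmul`): the set `{b ∈ A_ρ[ϖ^m] : φ^{2^R} b = q_v^{2^R} b}` counted by
  Greenberg–Vatsal's Prop. (2.4) (tree: `UniversalToricDescentUnramifiedLocalCount.exists_forall_natCard_subgroupH1_localSubgroup_eq`) is `{0}` —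
  the local block `H¹(ℚ_{∞,w}, A_ρ)` VANISHES at a good place of odd trace.
* §5 **EVEN trace** (`tr ρ(g) ∈ (ϖ)`): `ρ(g)^{2^R} = 1 + ϖ^R W` (`R ≥ 1`), so `g^{2^R}` FIXES `A[ϖ^m]` for `m ≤ R` (`Cofree.pow_two_pow_smul_eq_self`),
  `u^{2^R} ≡ 1 (mod ϖ^{R+1})` acts trivially too, hence `g^{2^R} • a = u^{2^R} • a` on `A[ϖ^m]` (`Cofree.pow_two_pow_smul_eq_pow_smul`,
  `…_eq_nsmul`): the counted set is ALL of `A_ρ[ϖ^m]` — the local block is the whole coefficient module `A_ρ(−1)`.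

These are the two fixed-point inputs of the local block DICHOTOMY `D_w ∈ {0, A_ρ}` at good places `w ∤ 2` (stub plan of crux RSL_g
`ResidualSignedLambdaLowerCMAtTwo`, `Summits/BirchSwinnertonDyer`, count clause `LocalBlockDichotomyCount`), stated frame-free (any decomposition
group acting through `ρ`). Nothing here is specific to BSD.

References: [GreenbergVatsal2000] R. Greenberg, V. Vatsal, *On the Iwasawa invariants of elliptic curves*, Invent. Math. 142 (2000), §2 Prop. (2.4)
and its proof (the local factor `H¹((ℚ_∞)_η, A) ≅ (A(−1))^{G/I}`, "the invariants of the prime-to-`p` part"); [GreenbergLNM1716] R. Greenberg, LNM 1716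
(1999), §3 Lemma 3.3; [SerreInventiones1972] J.-P. Serre, Invent. Math. 15 (1972), §1.8 Prop. 6 (fixed points of Frobenius powers on torsion).
-/

set_option autoImplicit false

noncomputable section

open scoped Classical

open Literature.NumberTheory.GaloisRepresentations

namespace Literature.NumberTheory.EllipticCurves.GreenbergSelmer

/-! ## §1 `2 × 2` matrices: trace/determinant identities and odd-trace rigidity in characteristic `2` (card k1-g11 §A) -/

section MatrixTwo

variable {R : Type*} [CommRing R]

/-- `tr (N·N) = (tr N)² − 2·det N` for a `2 × 2` matrix. Credit: card `stub-cmlambdalower-k1-g11` §A. [folklore] -/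
private theorem trace_mul_self_fin_two (N : Matrix (Fin 2) (Fin 2) R) : (N * N).trace = N.trace ^ 2 - 2 * N.det := by
  simp only [Matrix.trace_fin_two, Matrix.det_fin_two, Matrix.mul_apply, Fin.sum_univ_two]
  ring

/-- **Cayley–Hamilton for `2 × 2` matrices**: `N·N = tr N • N − det N • 1`. [folklore] -/
private theorem mul_self_fin_two (N : Matrix (Fin 2) (Fin 2) R) : N * N = N.trace • N - N.det • (1 : Matrix (Fin 2) (Fin 2) R) := by
  ext i j
  have h01 : (1 : Matrix (Fin 2) (Fin 2) R) 0 1 = 0 := Matrix.one_apply_ne (by decide)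
  have h10 : (1 : Matrix (Fin 2) (Fin 2) R) 1 0 = 0 := Matrix.one_apply_ne (by decide)
  have h00 : (1 : Matrix (Fin 2) (Fin 2) R) 0 0 = 1 := Matrix.one_apply_eq 0
  have h11 : (1 : Matrix (Fin 2) (Fin 2) R) 1 1 = 1 := Matrix.one_apply_eq 1
  fin_cases i <;> fin_cases j <;>
    simp only [Matrix.mul_apply, Fin.sum_univ_two, Matrix.sub_apply, Matrix.smul_apply, smul_eq_mul, Matrix.trace_fin_two,
      Matrix.det_fin_two, Fin.zero_eta, Fin.mk_one, Fin.isValue, h01, h10, h00, h11] <;>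
    ring

/-- In characteristic `2`: `tr (M ^ 2^r) = (tr M) ^ 2^r` for a `2 × 2` matrix (any determinant). Credit: card `stub-cmlambdalower-k1-g11` §A.
[folklore] -/
private theorem trace_pow_two_pow_of_two_eq_zero (h2 : (2 : R) = 0) (M : Matrix (Fin 2) (Fin 2) R) (r : ℕ) :
    (M ^ 2 ^ r).trace = M.trace ^ 2 ^ r := by
  induction r with
  | zero => simp
  | succ r ih =>
    have e1 : M ^ 2 ^ (r + 1) = M ^ 2 ^ r * M ^ 2 ^ r := by
      rw [pow_succ, pow_mul, pow_two]
    rw [e1, trace_mul_self_fin_two, h2, zero_mul, sub_zero, ih, ← pow_mul, ← pow_succ]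

/-- ODD-TRACE RIGIDITY (one matrix): over a commutative ring with `2 = 0`, a `2 × 2` matrix with `det = 1` and UNIT trace has no non-zero fixed
vector. Credit: card `stub-cmlambdalower-k1-g11` §A (there over a field). [cite: SerreInventiones1972, §1.8 Prop. 6] -/
theorem eq_zero_of_mulVec_eq_self (h2 : (2 : R) = 0) (N : Matrix (Fin 2) (Fin 2) R) (hdet : N.det = 1) (htr : IsUnit N.trace)
    (v : Fin 2 → R) (hv : N.mulVec v = v) : v = 0 := by
  have e0 : N 0 0 * v 0 + N 0 1 * v 1 = v 0 := by
    have h := congr_fun hv 0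
    rwa [Matrix.mulVec, dotProduct, Fin.sum_univ_two] at h
  have e1 : N 1 0 * v 0 + N 1 1 * v 1 = v 1 := by
    have h := congr_fun hv 1
    rwa [Matrix.mulVec, dotProduct, Fin.sum_univ_two] at h
  rw [Matrix.det_fin_two] at hdet
  obtain ⟨t, ht⟩ := htr
  have hx : N.trace * v 0 = 0 := by
    rw [Matrix.trace_fin_two]
    linear_combination (1 - N 1 1) * e0 + N 0 1 * e1 + v 0 * hdet + v 0 * h2
  have hy : N.trace * v 1 = 0 := by
    rw [Matrix.trace_fin_two]
    linear_combination N 1 0 * e0 + (1 - N 0 0) * e1 + v 1 * hdet + v 1 * h2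
  rw [← ht] at hx hy
  have hx' : v 0 = 0 := by simpa using congrArg (fun s ↦ (↑t⁻¹ : R) * s) hx
  have hy' : v 1 = 0 := by simpa using congrArg (fun s ↦ (↑t⁻¹ : R) * s) hy
  funext i
  fin_cases i
  · exact hx'
  · exact hy'

/-- ODD-TRACE RIGIDITY (all `2`-power iterates): with `2 = 0`, `det M = 1`, `tr M` a unit, no iterate `M ^ 2^r` has a non-zero fixed vector —
the fixed-point count `#{b : φ^{2^R} b = q^{2^R} b}` of Greenberg–Vatsal Prop. (2.4) is `1` at a good place of ODD trace.
Credit: card `stub-cmlambdalower-k1-g11` §A. [cite: GreenbergVatsal2000, §2 Prop. (2.4)] [cite: SerreInventiones1972, §1.8 Prop. 6] -/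
theorem eq_zero_of_pow_two_pow_mulVec_eq_self (h2 : (2 : R) = 0) (M : Matrix (Fin 2) (Fin 2) R) (hdet : M.det = 1) (htr : IsUnit M.trace)
    (r : ℕ) (v : Fin 2 → R) (hv : (M ^ 2 ^ r).mulVec v = v) : v = 0 := by
  refine eq_zero_of_mulVec_eq_self h2 (M ^ 2 ^ r) ?_ ?_ v hv
  · rw [Matrix.det_pow, hdet, one_pow]
  · rw [trace_pow_two_pow_of_two_eq_zero h2]
    exact htr.pow _

end MatrixTwo

/-! ## §2 Squaring towers: `(1 + ϖ • z)^{2^R} = 1 + ϖ^{R+1} • w` when `2 ∈ (ϖ)` -/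

section Tower

variable {𝒪 : Type*} [CommRing 𝒪] {A : Type*} [Ring A] [Algebra 𝒪 A]

/-- One squaring step: `(1 + ϖ^j • w)² = 1 + ϖ^{j+1} • (c • w + ϖ^{j-1} • (w·w))` for `j ≥ 1` and `2 = ϖ c` (`2ϖ^j = ϖ^{j+1} c`,
`ϖ^{2j} = ϖ^{j+1} ϖ^{j-1}`). [cite: SerreInventiones1972, §1.8 Prop. 6] -/
theorem one_add_smul_sq_eq (ϖ c : 𝒪) (h2 : (2 : 𝒪) = ϖ * c) (j : ℕ) (hj : 1 ≤ j) (w : A) :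
    (1 + ϖ ^ j • w) ^ 2 = 1 + ϖ ^ (j + 1) • (c • w + ϖ ^ (j - 1) • (w * w)) := by
  obtain ⟨i, rfl⟩ := Nat.exists_eq_add_of_le hj
  rw [Nat.add_sub_cancel_left]
  -- `y := ϖ^{1+i} • w`: `(1 + y)² = 1 + (y + y) + y·y`, `y + y = (ϖ^{2+i} c) • w`, `y·y = (ϖ^{2+i} ϖ^i) • (w·w)`
  have hyy : (ϖ ^ (1 + i) • w) * (ϖ ^ (1 + i) • w) = (ϖ ^ (1 + i + 1) * ϖ ^ i) • (w * w) := by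
    rw [smul_mul_assoc, mul_smul_comm, ← mul_smul]
    congr 1
    ring
  have h2y : ϖ ^ (1 + i) • w + ϖ ^ (1 + i) • w = (ϖ ^ (1 + i + 1) * c) • w := by
    rw [← two_smul 𝒪 (ϖ ^ (1 + i) • w), ← mul_smul]
    congr 1
    rw [h2]
    ring
  have hL : (1 + ϖ ^ (1 + i) • w) ^ 2 = 1 + (ϖ ^ (1 + i) • w + ϖ ^ (1 + i) • w) + (ϖ ^ (1 + i) • w) * (ϖ ^ (1 + i) • w) := by
    rw [sq, add_mul, one_mul, mul_add, mul_one]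
    abel
  rw [hL, h2y, hyy, smul_add, ← mul_smul, ← mul_smul, add_assoc]

/-- **The squaring tower**: in any `𝒪`-algebra, if `2 = ϖ c` then `(1 + ϖ • z)^{2^R} = 1 + ϖ^{R+1} • w_R` for some `w_R` (and every `R ≥ 0`).
Applied to `A = M₂(𝒪)` (`ρ(g)² = 1 + ϖ P` at even trace) and to `A = 𝒪` (`u = 1 + ϖ d`). [cite: SerreInventiones1972, §1.8 Prop. 6] -/
theorem exists_one_add_smul_pow_two_pow_eq (ϖ c : 𝒪) (h2 : (2 : 𝒪) = ϖ * c) (z : A) (R : ℕ) :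
    ∃ w : A, (1 + ϖ • z) ^ 2 ^ R = 1 + ϖ ^ (R + 1) • w := by
  induction R with
  | zero => exact ⟨z, by rw [pow_zero, pow_one, zero_add, pow_one]⟩
  | succ R ih =>
    obtain ⟨w, hw⟩ := ih
    refine ⟨c • w + ϖ ^ (R + 1 - 1) • (w * w), ?_⟩
    rw [pow_succ, pow_mul, hw, one_add_smul_sq_eq ϖ c h2 (R + 1) (Nat.le_add_left 1 R) w]

end Tower

/-! ## §3 The cofree module `A = F²/𝒪²`: lattice bookkeeping, the `ϖ`-torsion layer, and `ϖ^m`-torsion by induction -/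

section CofreeLayers

variable {G : Type*} [Group G] [TopologicalSpace G] {𝒪 : Type*} [CommRing 𝒪] [TopologicalSpace 𝒪]
  (F : Type*) [Field F] [Algebra 𝒪 F] (ρ : FramedRep G 𝒪 2)

omit [TopologicalSpace G] [TopologicalSpace 𝒪] in
/-- The lattice `𝒪² ⊆ F²` is stable under every matrix with entries in `𝒪` (mapped to `F`): `W_F (ι ∘ y) = ι ∘ (W y)` (`RingHom.map_mulVec`).
[folklore] -/
private theorem mulVec_map_mem_lattice (W : Matrix (Fin 2) (Fin 2) 𝒪) {y : Fin 2 → F} (hy : y ∈ lattice 2 𝒪 F) :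
    (W.map (algebraMap 𝒪 F)).mulVec y ∈ lattice 2 𝒪 F := by
  obtain ⟨y₀, rfl⟩ := (mem_lattice_iff y).1 hy
  refine (mem_lattice_iff _).2 ⟨W.mulVec y₀, funext fun i ↦ ?_⟩
  exact RingHom.map_mulVec (algebraMap 𝒪 F) W y₀ i

/-- The action of `h ∈ G` on `F²` is the mapped matrix `ρ(h)` acting by `mulVec` (restating `fracRepresentation_apply_apply` with the `GL₂`
coercions in the form used below). [folklore] -/
private theorem fracRepresentation_eq_map_mulVec (h : G) (x : Fin 2 → F) :
    fracRepresentation F ρ h x = ((ρ h : Matrix (Fin 2) (Fin 2) 𝒪).map (algebraMap 𝒪 F)).mulVec x :=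
  fracRepresentation_apply_apply F ρ h x

/-- **The `ϖ`-torsion layer.** `𝒪 → F` injective, `ϖ ≠ 0`; `h ∈ G`, `u ∈ 𝒪`. If `ρ̄(h) − ū` has trivial kernel on `(𝒪/ϖ)²` (`hfix`), then a
class `a ∈ A = F²/𝒪²` with `ϖ • a = 0` and `h • a = u • a` is `0`: writing `a = x mod 𝒪²` with `ϖ x = y ∈ 𝒪²`, the relation `ρ(h)x − u x ∈ 𝒪²`
multiplied by `ϖ` reads `ρ(h) y − u y ∈ ϖ𝒪²`, so `ȳ ∈ ker(ρ̄(h) − ū) = 0`, `y ∈ ϖ𝒪²`, `x ∈ 𝒪²`.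
[cite: GreenbergVatsal2000, §2 Prop. (2.4)] [cite: SerreInventiones1972, §1.8 Prop. 6] -/
theorem Cofree.eq_zero_of_smul_eq_smul_of_torsion_one (ϖ : 𝒪) (hinj : Function.Injective (algebraMap 𝒪 F)) (hϖ : ϖ ≠ 0) (h : G) (u : 𝒪)
    (hfix : ∀ v : Fin 2 → 𝒪 ⧸ Ideal.span {ϖ},
      ((ρ h : Matrix (Fin 2) (Fin 2) 𝒪).map (Ideal.Quotient.mk (Ideal.span {ϖ}))).mulVec v = (Ideal.Quotient.mk (Ideal.span {ϖ}) u) • v →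
        v = 0)
    (a : Cofree ρ F) (ha : ϖ • a = 0) (hha : h • a = u • a) : a = 0 := by
  set M : Matrix (Fin 2) (Fin 2) 𝒪 := (ρ h : Matrix (Fin 2) (Fin 2) 𝒪) with hM
  have hϖF : algebraMap 𝒪 F ϖ ≠ 0 := fun h0 ↦ hϖ (hinj (by rw [h0, map_zero]))
  obtain ⟨x, rfl⟩ := cofreeMk_surjective F ρ a
  -- `ϖ x = ι ∘ y` with `y ∈ 𝒪²`
  rw [← map_smul, ← LinearMap.mem_ker, ker_cofreeMk] at ha
  obtain ⟨y, hy⟩ := (mem_lattice_iff _).1 ha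
  have hyi : ∀ i, algebraMap 𝒪 F (y i) = algebraMap 𝒪 F ϖ * x i := fun i ↦ by
    have e := congr_fun hy i
    rwa [Pi.smul_apply, Algebra.smul_def] at e
  -- `ρ(h) x − u x = ι ∘ z` with `z ∈ 𝒪²`
  rw [smul_cofreeMk, ← map_smul, ← sub_eq_zero, ← map_sub, ← LinearMap.mem_ker, ker_cofreeMk] at hha
  obtain ⟨z, hz⟩ := (mem_lattice_iff _).1 hha
  have hzi : ∀ i, algebraMap 𝒪 F (z i) = (M.map (algebraMap 𝒪 F)).mulVec x i - algebraMap 𝒪 F u * x i := fun i ↦ by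
    have e := congr_fun hz i
    rwa [Pi.sub_apply, Pi.smul_apply, Algebra.smul_def, fracRepresentation_eq_map_mulVec] at e
  -- the integral relation `M y − u y = ϖ z`
  have hint : ∀ i, M.mulVec y i - u * y i = ϖ * z i := by
    intro i
    apply hinj
    have e1 : algebraMap 𝒪 F (M.mulVec y i) = (M.map (algebraMap 𝒪 F)).mulVec (fun j ↦ algebraMap 𝒪 F (y j)) i :=
      RingHom.map_mulVec (algebraMap 𝒪 F) M y i
    have e2 : (fun j ↦ algebraMap 𝒪 F (y j)) = algebraMap 𝒪 F ϖ • x := by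
      funext j
      rw [hyi, Pi.smul_apply, smul_eq_mul]
    rw [map_sub, map_mul, map_mul, e1, e2, Matrix.mulVec_smul, Pi.smul_apply, smul_eq_mul, hyi, hzi]
    ring
  -- reduce modulo `ϖ`: `ȳ ∈ ker(ρ̄(h) − ū)`
  have hbar : (M.map (Ideal.Quotient.mk (Ideal.span {ϖ}))).mulVec (fun j ↦ Ideal.Quotient.mk (Ideal.span {ϖ}) (y j)) =
      (Ideal.Quotient.mk (Ideal.span {ϖ}) u) • fun j ↦ Ideal.Quotient.mk (Ideal.span {ϖ}) (y j) := by
    funext i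
    have e1 := RingHom.map_mulVec (Ideal.Quotient.mk (Ideal.span {ϖ})) M y i
    rw [Function.comp_def] at e1
    rw [← e1, Pi.smul_apply, smul_eq_mul, ← map_mul, ← sub_eq_zero, ← map_sub, Ideal.Quotient.eq_zero_iff_mem, hint i]
    exact Ideal.mul_mem_right _ _ (Ideal.mem_span_singleton_self ϖ)
  have hy0 : ∀ i, y i ∈ Ideal.span {ϖ} := fun i ↦ by
    have e := congr_fun (hfix _ hbar) i
    rw [Pi.zero_apply, Ideal.Quotient.eq_zero_iff_mem] at e
    exact e
  choose y' hy' using fun i ↦ Ideal.mem_span_singleton'.1 (hy0 i)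
  -- conclude `x = ι ∘ y' ∈ 𝒪²`
  rw [← LinearMap.mem_ker, ker_cofreeMk]
  refine (mem_lattice_iff x).2 ⟨y', funext fun i ↦ ?_⟩
  have e : algebraMap 𝒪 F (y' i) * algebraMap 𝒪 F ϖ = x i * algebraMap 𝒪 F ϖ := by
    rw [← map_mul, hy' i, hyi i, mul_comm]
  exact mul_right_cancel₀ hϖF e

/-- **`ϖ^m`-torsion by induction on `m`**: under the same `hfix`, every class `a` with `ϖ^m • a = 0` and `h • a = u • a` is `0` (apply the
`ϖ`-torsion layer to `ϖ^{m-1} • a`, …, using that the `G`-action is `𝒪`-linear). [cite: GreenbergVatsal2000, §2 Prop. (2.4)]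
[cite: SerreInventiones1972, §1.8 Prop. 6] -/
theorem Cofree.eq_zero_of_smul_eq_smul_of_torsion (ϖ : 𝒪) (hinj : Function.Injective (algebraMap 𝒪 F)) (hϖ : ϖ ≠ 0) (h : G) (u : 𝒪)
    (hfix : ∀ v : Fin 2 → 𝒪 ⧸ Ideal.span {ϖ},
      ((ρ h : Matrix (Fin 2) (Fin 2) 𝒪).map (Ideal.Quotient.mk (Ideal.span {ϖ}))).mulVec v = (Ideal.Quotient.mk (Ideal.span {ϖ}) u) • v →
        v = 0)
    (m : ℕ) : ∀ a : Cofree ρ F, ϖ ^ m • a = 0 → h • a = u • a → a = 0 := by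
  induction m with
  | zero =>
    intro a ha _
    rwa [pow_zero, one_smul] at ha
  | succ m ih =>
    intro a ha hha
    have hϖa : ϖ • a = 0 := by
      refine ih (ϖ • a) ?_ ?_
      · rw [← mul_smul, ← pow_succ, ha]
      · rw [smul_comm, hha, smul_comm]
    exact Cofree.eq_zero_of_smul_eq_smul_of_torsion_one F ρ ϖ hinj hϖ h u hfix a hϖa hha

end CofreeLayers

/-! ## §4 ODD trace: no twisted fixed points of any `2`-power iterate on `A[ϖ^∞]` -/

section OddTrace

variable {G : Type*} [Group G] [TopologicalSpace G] {𝒪 : Type*} [CommRing 𝒪] [TopologicalSpace 𝒪]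
  (F : Type*) [Field F] [Algebra 𝒪 F] (ρ : FramedRep G 𝒪 2)

/-- **ODD-trace rigidity on the cofree module.** `(ϖ)` maximal with `2 ∈ (ϖ)`, `𝒪 → F` injective, `ϖ ≠ 0`; `g ∈ G` with `det ρ(g) ≡ 1` and
`tr ρ(g) ∉ (ϖ)`; `u ≡ 1 (mod ϖ)`. Then for every `R` and every `ϖ`-power-torsion class `a ∈ A = F²/𝒪²`: `g^{2^R} • a = u • a ⟹ a = 0`.
(The reduction `ρ̄(g) ∈ GL₂(𝒪/ϖ)` has `det = 1` and unit trace in characteristic `2`, so `ρ̄(g)^{2^R} − 1` is invertible by §1; lift along the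
`ϖ`-adic layers by §3.) In Greenberg–Vatsal's Prop. (2.4) at a good place of odd trace: `{b ∈ A_ρ[ϖ^m] : φ^{2^R} b = q^{2^R} b} = 0` for all `R`,
i.e. the local block `H¹(ℚ_{∞,w}, A_ρ) = 0`. [cite: GreenbergVatsal2000, §2 Prop. (2.4)] [cite: GreenbergLNM1716, §3 Lemma 3.3] -/
theorem Cofree.eq_zero_of_pow_two_pow_smul_eq_smul (ϖ : 𝒪) (hmax : (Ideal.span {ϖ}).IsMaximal) (h2 : (2 : 𝒪) ∈ Ideal.span {ϖ})
    (hinj : Function.Injective (algebraMap 𝒪 F)) (hϖ : ϖ ≠ 0) (g : G)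
    (hdet : (ρ g : Matrix (Fin 2) (Fin 2) 𝒪).det - 1 ∈ Ideal.span {ϖ}) (htr : (ρ g : Matrix (Fin 2) (Fin 2) 𝒪).trace ∉ Ideal.span {ϖ})
    (u : 𝒪) (hu : u - 1 ∈ Ideal.span {ϖ}) (R : ℕ) (a : Cofree ρ F) (ha : ∃ m : ℕ, ϖ ^ m • a = 0) (hga : g ^ 2 ^ R • a = u • a) :
    a = 0 := by
  obtain ⟨m, hm⟩ := ha
  -- the residue ring `𝒪/(ϖ)`: characteristic `2`, non-zero elements are units
  have hk2 : (2 : 𝒪 ⧸ Ideal.span {ϖ}) = 0 := by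
    rw [← map_ofNat (Ideal.Quotient.mk (Ideal.span {ϖ})) 2, Ideal.Quotient.eq_zero_iff_mem]
    exact h2
  have hu1 : Ideal.Quotient.mk (Ideal.span {ϖ}) u = 1 := by
    rw [← map_one (Ideal.Quotient.mk (Ideal.span {ϖ})), Ideal.Quotient.eq]
    exact hu
  have hdet' : ((ρ g : Matrix (Fin 2) (Fin 2) 𝒪).map (Ideal.Quotient.mk (Ideal.span {ϖ}))).det = 1 := by
    rw [← RingHom.mapMatrix_apply, ← RingHom.map_det, ← map_one (Ideal.Quotient.mk (Ideal.span {ϖ})), Ideal.Quotient.eq]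
    exact hdet
  have htr' : IsUnit ((ρ g : Matrix (Fin 2) (Fin 2) 𝒪).map (Ideal.Quotient.mk (Ideal.span {ϖ}))).trace := by
    rw [← AddMonoidHom.map_trace (Ideal.Quotient.mk (Ideal.span {ϖ}))]
    have hne : Ideal.Quotient.mk (Ideal.span {ϖ}) (ρ g : Matrix (Fin 2) (Fin 2) 𝒪).trace ≠ 0 :=
      fun h0 ↦ htr (Ideal.Quotient.eq_zero_iff_mem.1 h0)
    obtain ⟨b, hb⟩ := ((Ideal.Quotient.maximal_ideal_iff_isField_quotient _).1 hmax).mul_inv_cancel hne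
    exact isUnit_iff_exists_inv.2 ⟨b, hb⟩
  have hpow : ((ρ (g ^ 2 ^ R) : Matrix (Fin 2) (Fin 2) 𝒪).map (Ideal.Quotient.mk (Ideal.span {ϖ}))) =
      ((ρ g : Matrix (Fin 2) (Fin 2) 𝒪).map (Ideal.Quotient.mk (Ideal.span {ϖ}))) ^ 2 ^ R := by
    rw [map_pow ρ, Units.val_pow_eq_pow_val, ← RingHom.mapMatrix_apply, map_pow, RingHom.mapMatrix_apply]
  refine Cofree.eq_zero_of_smul_eq_smul_of_torsion F ρ ϖ hinj hϖ (g ^ 2 ^ R) u (fun v hv ↦ ?_) m a hm hga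
  rw [hpow, hu1, one_smul] at hv
  exact eq_zero_of_pow_two_pow_mulVec_eq_self hk2 _ hdet' htr' R v hv

/-- **ODD trace, `ℕ`-scalar form** (the shape of Greenberg–Vatsal's fixed-point set `{b : φ^{p^R} • b = q_v^{p^R} • b}` at `p = 2`): for `q` odd,
`g^{2^R} • a = q^{2^R} • a` with `a ∈ A[ϖ^∞]` forces `a = 0`. [cite: GreenbergVatsal2000, §2 Prop. (2.4)] [cite: GreenbergLNM1716, §3 Lemma 3.3] -/
theorem Cofree.eq_zero_of_pow_two_pow_smul_eq_nsmul (ϖ : 𝒪) (hmax : (Ideal.span {ϖ}).IsMaximal) (h2 : (2 : 𝒪) ∈ Ideal.span {ϖ})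
    (hinj : Function.Injective (algebraMap 𝒪 F)) (hϖ : ϖ ≠ 0) (g : G)
    (hdet : (ρ g : Matrix (Fin 2) (Fin 2) 𝒪).det - 1 ∈ Ideal.span {ϖ}) (htr : (ρ g : Matrix (Fin 2) (Fin 2) 𝒪).trace ∉ Ideal.span {ϖ})
    (q : ℕ) (hq : Odd q) (R : ℕ) (a : Cofree ρ F) (ha : ∃ m : ℕ, ϖ ^ m • a = 0) (hga : g ^ 2 ^ R • a = (q ^ 2 ^ R) • a) :
    a = 0 := by
  refine Cofree.eq_zero_of_pow_two_pow_smul_eq_smul F ρ ϖ hmax h2 hinj hϖ g hdet htr ((q ^ 2 ^ R : ℕ) : 𝒪) ?_ R a ha ?_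
  · obtain ⟨j, hj⟩ := (hq.pow (n := 2 ^ R))
    have e : ((q ^ 2 ^ R : ℕ) : 𝒪) - 1 = 2 * (j : 𝒪) := by
      rw [hj]
      push_cast
      ring
    rw [e]
    exact Ideal.mul_mem_right _ _ h2
  · rwa [Nat.cast_smul_eq_nsmul]

end OddTrace

/-! ## §5 EVEN trace: `g^{2^R}` and `u^{2^R}` both act trivially on `A[ϖ^m]` for `m ≤ R` -/

section EvenTrace

variable {G : Type*} [Group G] [TopologicalSpace G] {𝒪 : Type*} [CommRing 𝒪] [TopologicalSpace 𝒪]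
  (F : Type*) [Field F] [Algebra 𝒪 F] (ρ : FramedRep G 𝒪 2)

/-- **EVEN trace: `ρ(g)² = 1 + ϖ P`** when `tr ρ(g) ∈ (ϖ)`, `det ρ(g) ≡ 1` and `2 ∈ (ϖ)` (Cayley–Hamilton: `M² = tr M • M − det M • 1 ≡ −1 ≡ 1`).
[cite: GreenbergVatsal2000, §2 Prop. (2.4)] -/
theorem exists_sq_eq_one_add_smul_of_trace_mem (ϖ : 𝒪) (h2 : (2 : 𝒪) ∈ Ideal.span {ϖ}) (g : G)
    (hdet : (ρ g : Matrix (Fin 2) (Fin 2) 𝒪).det - 1 ∈ Ideal.span {ϖ}) (htr : (ρ g : Matrix (Fin 2) (Fin 2) 𝒪).trace ∈ Ideal.span {ϖ}) :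
    ∃ P : Matrix (Fin 2) (Fin 2) 𝒪, (ρ g : Matrix (Fin 2) (Fin 2) 𝒪) * (ρ g : Matrix (Fin 2) (Fin 2) 𝒪) = 1 + ϖ • P := by
  set M : Matrix (Fin 2) (Fin 2) 𝒪 := (ρ g : Matrix (Fin 2) (Fin 2) 𝒪) with hM
  obtain ⟨t, ht⟩ := Ideal.mem_span_singleton'.1 htr
  obtain ⟨d, hd⟩ := Ideal.mem_span_singleton'.1 hdet
  obtain ⟨c, hc⟩ := Ideal.mem_span_singleton'.1 h2
  refine ⟨t • M - d • (1 : Matrix (Fin 2) (Fin 2) 𝒪) - c • (1 : Matrix (Fin 2) (Fin 2) 𝒪), ?_⟩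
  have hdet' : M.det = 1 + d * ϖ := by rw [hd]; ring
  rw [mul_self_fin_two, ← ht, hdet', smul_sub, smul_sub, ← mul_smul, ← mul_smul, ← mul_smul, mul_comm ϖ t, mul_comm ϖ d, mul_comm ϖ c, hc]
  -- `(1 + dϖ) • 1 = 1 + (dϖ) • 1` and `−1 = 1 − 2 • 1`
  rw [add_smul, one_smul]
  have e2 : (2 : 𝒪) • (1 : Matrix (Fin 2) (Fin 2) 𝒪) = 1 + 1 := by rw [two_smul]
  rw [e2]
  abel

/-- **EVEN trace: `ρ(g)^{2^R} = 1 + ϖ^R W` for `R ≥ 1`** (the squaring tower §2 in `M₂(𝒪)` started at `ρ(g)² = 1 + ϖ P`).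
[cite: GreenbergVatsal2000, §2 Prop. (2.4)] [cite: SerreInventiones1972, §1.8 Prop. 6] -/
theorem exists_pow_two_pow_eq_one_add_smul_of_trace_mem (ϖ : 𝒪) (h2 : (2 : 𝒪) ∈ Ideal.span {ϖ}) (g : G)
    (hdet : (ρ g : Matrix (Fin 2) (Fin 2) 𝒪).det - 1 ∈ Ideal.span {ϖ}) (htr : (ρ g : Matrix (Fin 2) (Fin 2) 𝒪).trace ∈ Ideal.span {ϖ})
    (R : ℕ) (hR : 1 ≤ R) :
    ∃ W : Matrix (Fin 2) (Fin 2) 𝒪, (ρ g : Matrix (Fin 2) (Fin 2) 𝒪) ^ 2 ^ R = 1 + ϖ ^ R • W := by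
  obtain ⟨P, hP⟩ := exists_sq_eq_one_add_smul_of_trace_mem ρ ϖ h2 g hdet htr
  obtain ⟨c, hc⟩ := Ideal.mem_span_singleton'.1 h2
  obtain ⟨R', rfl⟩ := Nat.exists_eq_add_of_le hR
  obtain ⟨w, hw⟩ := exists_one_add_smul_pow_two_pow_eq (A := Matrix (Fin 2) (Fin 2) 𝒪) ϖ c (by rw [← hc, mul_comm]) P R'
  refine ⟨w, ?_⟩
  rw [pow_add, pow_one, pow_mul, pow_two, hP, hw, add_comm 1 R']

/-- **EVEN trace: `g^{2^R}` FIXES `A[ϖ^m]` for `m ≤ R`**: for `a = x mod 𝒪²` with `ϖ^m x ∈ 𝒪²`, `ρ(g)^{2^R} x − x = W (ϖ^{R−m} ϖ^m x) ∈ 𝒪²`.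
In Greenberg–Vatsal's Prop. (2.4) at a good place of even trace the counted set `{b ∈ A_ρ[ϖ^m] : φ^{2^R} b = q^{2^R} b}` is therefore ALL of `A_ρ[ϖ^m]`
(with `Cofree.pow_two_pow_smul_eq_pow_smul`): the local block is the whole coefficient module. [cite: GreenbergVatsal2000, §2 Prop. (2.4)]
[cite: GreenbergLNM1716, §3 Lemma 3.3] -/
theorem Cofree.pow_two_pow_smul_eq_self (ϖ : 𝒪) (h2 : (2 : 𝒪) ∈ Ideal.span {ϖ}) (g : G)
    (hdet : (ρ g : Matrix (Fin 2) (Fin 2) 𝒪).det - 1 ∈ Ideal.span {ϖ}) (htr : (ρ g : Matrix (Fin 2) (Fin 2) 𝒪).trace ∈ Ideal.span {ϖ})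
    (m R : ℕ) (hmR : m ≤ R) (a : Cofree ρ F) (ha : ϖ ^ m • a = 0) : g ^ 2 ^ R • a = a := by
  by_cases hm0 : m = 0
  · subst hm0
    rw [pow_zero, one_smul] at ha
    rw [ha, smul_zero]
  have hm : 0 < m := Nat.pos_of_ne_zero hm0
  obtain ⟨W, hW⟩ := exists_pow_two_pow_eq_one_add_smul_of_trace_mem ρ ϖ h2 g hdet htr R (hm.trans_le hmR)
  obtain ⟨x, rfl⟩ := cofreeMk_surjective F ρ a
  rw [← map_smul, ← LinearMap.mem_ker, ker_cofreeMk] at ha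
  rw [smul_cofreeMk, ← sub_eq_zero, ← map_sub, ← LinearMap.mem_ker, ker_cofreeMk, fracRepresentation_eq_map_mulVec, map_pow ρ,
    Units.val_pow_eq_pow_val, hW, Matrix.map_add (algebraMap 𝒪 F) (map_add (algebraMap 𝒪 F)),
    Matrix.map_one (algebraMap 𝒪 F) (map_zero _) (map_one _), Matrix.add_mulVec, Matrix.one_mulVec, add_sub_cancel_left]
  have hmap : (ϖ ^ R • W).map (algebraMap 𝒪 F) = algebraMap 𝒪 F (ϖ ^ R) • W.map (algebraMap 𝒪 F) := by
    ext i j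
    simp only [Matrix.map_apply, Matrix.smul_apply, smul_eq_mul, map_mul]
  obtain ⟨i, rfl⟩ := Nat.exists_eq_add_of_le hmR
  rw [hmap, Matrix.smul_mulVec, ← Matrix.mulVec_smul, algebraMap_smul F (ϖ ^ (m + i)) x, pow_add, mul_comm (ϖ ^ m) (ϖ ^ i), mul_smul]
  exact mulVec_map_mem_lattice F W ((lattice 2 𝒪 F).smul_mem (ϖ ^ i) ha)

/-- A scalar `u ≡ 1 (mod ϖ^m)` acts trivially on `A[ϖ^m]`. [folklore] -/
private theorem Cofree.smul_eq_self_of_sub_one_mem (ϖ : 𝒪) (u : 𝒪) (m : ℕ) (hu : u - 1 ∈ Ideal.span {ϖ ^ m}) (a : Cofree ρ F)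
    (ha : ϖ ^ m • a = 0) : u • a = a := by
  obtain ⟨d, hd⟩ := Ideal.mem_span_singleton'.1 hu
  have e : u = 1 + d * ϖ ^ m := by rw [hd]; ring
  rw [e, add_smul, one_smul, mul_smul, ha, smul_zero, add_zero]

omit [TopologicalSpace G] [TopologicalSpace 𝒪] in
/-- `u ≡ 1 (mod ϖ)` and `2 ∈ (ϖ)` ⟹ `u^{2^R} ≡ 1 (mod ϖ^{R+1})` (the squaring tower §2 in `𝒪`). [cite: SerreInventiones1972, §1.8 Prop. 6] -/
theorem pow_two_pow_sub_one_mem_span_pow (ϖ : 𝒪) (h2 : (2 : 𝒪) ∈ Ideal.span {ϖ}) (u : 𝒪) (hu : u - 1 ∈ Ideal.span {ϖ}) (R : ℕ) :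
    u ^ 2 ^ R - 1 ∈ Ideal.span {ϖ ^ (R + 1)} := by
  obtain ⟨c, hc⟩ := Ideal.mem_span_singleton'.1 h2
  obtain ⟨d, hd⟩ := Ideal.mem_span_singleton'.1 hu
  have e : u = 1 + ϖ • d := by rw [smul_eq_mul, mul_comm, hd]; ring
  obtain ⟨w, hw⟩ := exists_one_add_smul_pow_two_pow_eq (A := 𝒪) ϖ c (by rw [← hc, mul_comm]) d R
  rw [e, hw, smul_eq_mul, add_sub_cancel_left]
  exact Ideal.mem_span_singleton'.2 ⟨w, mul_comm _ _⟩

/-- **EVEN trace: `g^{2^R} • a = u^{2^R} • a` on `A[ϖ^m]` for `m ≤ R`** (`u ≡ 1 (mod ϖ)`): both sides equal `a`. The dichotomy's second branch: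
the fixed-point set of Greenberg–Vatsal Prop. (2.4) is all of `A_ρ[ϖ^m]`. [cite: GreenbergVatsal2000, §2 Prop. (2.4)] [cite: GreenbergLNM1716, §3 Lemma 3.3] -/
theorem Cofree.pow_two_pow_smul_eq_pow_smul (ϖ : 𝒪) (h2 : (2 : 𝒪) ∈ Ideal.span {ϖ}) (g : G)
    (hdet : (ρ g : Matrix (Fin 2) (Fin 2) 𝒪).det - 1 ∈ Ideal.span {ϖ}) (htr : (ρ g : Matrix (Fin 2) (Fin 2) 𝒪).trace ∈ Ideal.span {ϖ})
    (u : 𝒪) (hu : u - 1 ∈ Ideal.span {ϖ}) (m R : ℕ) (hmR : m ≤ R) (a : Cofree ρ F) (ha : ϖ ^ m • a = 0) :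
    g ^ 2 ^ R • a = u ^ 2 ^ R • a := by
  have hu' : u ^ 2 ^ R - 1 ∈ Ideal.span {ϖ ^ m} := by
    have hle : Ideal.span {ϖ ^ (R + 1)} ≤ Ideal.span {ϖ ^ m} :=
      Ideal.span_singleton_le_span_singleton.2 (pow_dvd_pow ϖ (by omega))
    exact hle (pow_two_pow_sub_one_mem_span_pow ϖ h2 u hu R)
  rw [Cofree.pow_two_pow_smul_eq_self F ρ ϖ h2 g hdet htr m R hmR a ha,
    Cofree.smul_eq_self_of_sub_one_mem F ρ ϖ (u ^ 2 ^ R) m hu' a ha]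

/-- **EVEN trace, `ℕ`-scalar form**: for `q` odd, `g^{2^R} • a = q^{2^R} • a` on `A[ϖ^m]`, `m ≤ R`. [cite: GreenbergVatsal2000, §2 Prop. (2.4)]
[cite: GreenbergLNM1716, §3 Lemma 3.3] -/
theorem Cofree.pow_two_pow_smul_eq_nsmul (ϖ : 𝒪) (h2 : (2 : 𝒪) ∈ Ideal.span {ϖ}) (g : G)
    (hdet : (ρ g : Matrix (Fin 2) (Fin 2) 𝒪).det - 1 ∈ Ideal.span {ϖ}) (htr : (ρ g : Matrix (Fin 2) (Fin 2) 𝒪).trace ∈ Ideal.span {ϖ})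
    (q : ℕ) (hq : Odd q) (m R : ℕ) (hmR : m ≤ R) (a : Cofree ρ F) (ha : ϖ ^ m • a = 0) :
    g ^ 2 ^ R • a = (q ^ 2 ^ R) • a := by
  have hq1 : (q : 𝒪) - 1 ∈ Ideal.span {ϖ} := by
    obtain ⟨j, hj⟩ := hq
    have e : (q : 𝒪) - 1 = 2 * (j : 𝒪) := by
      rw [hj]
      push_cast
      ring
    rw [e]
    exact Ideal.mul_mem_right _ _ h2
  rw [Cofree.pow_two_pow_smul_eq_pow_smul F ρ ϖ h2 g hdet htr (q : 𝒪) hq1 m R hmR a ha, ← Nat.cast_pow, Nat.cast_smul_eq_nsmul]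

end EvenTrace

end Literature.NumberTheory.EllipticCurves.GreenbergSelmer

end
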